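import Summits.QuantumFields.YangMills.Theorems.UnitScaleTiltHistoryTailAlphaTopPlaquette
import Summits.QuantumFields.YangMills.Theorems.UnitScaleTiltHistoryTailBlockFootprint
import Summits.QuantumFields.YangMills.Theorems.UnitScaleTiltHistoryTailRemainder

/-!
# Route `UnitScaleTilt` — crux K2 `HistoryTail` (stmt-QuantumFields-18916): (71) FOR THE TOP-LEVEL LARGE PLAQUETTE OF A HISTORY, ASSEMBLED —
# `¼·p(g_{K−j})² ≤ β_K·Σ_{q ∈ R₀}(1 − Re tr U_j(h,W)(∂q))` for the composite minimiser, from the interface clauses (42)/(67) `Constraint42Top` and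
# (68) `Regularity68Levels`, ONE fine-box inclusion `toFine j p′.src + [−8L^j, 8L^j]³ ⊆ Ω_j(h)`, and two explicit smallness conditions on
# `θBal(K−j)` (support file; S5 «top-level small factor», both cuts v5r/v5p)

Fleet lead `ym-ust-18916-p1` (gen 2), 2026-08-26.  Assembles the landed pieces: the regions under a plaquette (`HistoryTailBlockRegions.
exists_nested_regions`, p469626), their fine footprint (`HistoryTailBlockFootprint.mem_plaqsIn_of_fineBox_subset`, p472506), the feed of the local
(69)–(71) chain at the composite minimiser (`HistoryTailAlphaTopPlaquette.smallFactor71_top`, p466694), and the remainder bookkeeping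
(`HistoryTailRemainder.remainder_le`, p445870) with the weights `ε_s = ¼·2^{−(j−s)}` (`Π(1+ε_s) ≤ e^{1/4} ≤ 3/2`, `1 + ε_s⁻¹ ≤ 5·2^{j−s}`) and the count
`#R_{s+1} ≤ 216·(L³)^{j−1−s}`.  Result **`quarter_pFun_sq_le_localAction`**: for an admissible pair `(h, W)`, a level-`j` plaquette `p′` whose fine
neighbourhood `toFine j p′.src + [−8L^j, 8L^j]³` lies in `Ω_j(h)` and which is `θBal(K−j)`-large for the datum, and `θ = θBal(K−j)` small in the two
explicit senses `(5L)²/4·C68·θ ≤ 1/10` (local Stokes regime) and `540·435²·(C68·(5L)²/4)⁴·θ² ≤ 1/4` (remainder `≤ ¼p²`):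
`¼·p(g_{K−j})² ≤ β_K·Σ_{q∈R₀}(1 − Re tr U_j(h,W)(∂q))` with `R₀` the level-0 region under `p′` (base sites within `3(L^j − 1)` of `toFine j p′.src`) —
[Balaban1985UV3] (71) p.273 «(1/g_k²)·[the action localized to Δ′] ≥ ¼p²(g_j) … for g_j sufficiently small», quantitatively, for the route's averaging and
the DATUM's own large plaquette (the case `SmallFactor71` does not cover: `LargePSpec` has `i < j`).  The region `R₀` is a box of radius `3L^j` (larger
than print's `Δ′` = the four corner blocks); for the decoupling any bounded neighbourhood serves.

References: T. Bałaban, CMP 102 (1985) 255–275 [Balaban1985UV3] ((42) p.266, (67)–(71) p.273).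
-/

noncomputable section

open scoped BigOperators

namespace Summit.QuantumFields.YangMills.Theorems.HistoryTailAlphaTopQuarter

open Literature.MathematicalPhysics.QuantumFieldTheory.Balaban1983to89
open T4Continuum BlockAveraging
open B10Eq47AxialChi (shiftN)
open T3ContinuumYM3Torus T3UnitScaleTilt T3UnitLawDensityEML
open T3AlphaInputsAC
open B10Eq38TorusDomains (toFine cornerSet plaqsIn mem_plaqsIn_iff)
open T3FinestHeightTail (beta_mul_θBal_sq)
open Summit.QuantumFields.YangMills.Theorems.HistoryTailAlphaTopPlaquette (Λ_top smallFactor71_top)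
open Summit.QuantumFields.YangMills.Theorems.HistoryTailBlockRegions (exists_nested_regions shift_apply')
open Summit.QuantumFields.YangMills.Theorems.HistoryTailBlockFootprint (mem_plaqsIn_of_fineBox_subset toFine_add_intVec toFine_ctr box_mono shift_mem_box)
open Summit.QuantumFields.YangMills.Theorems.HistoryTailRemainder (remainder_le prod_one_add_geometric_le)

variable {F : T3Family} {γ : ℝ} {D : AlphaDataT3 F γ}

/-- `e^{1/4} ≤ 3/2` (`|e^x − 1 − x| ≤ x²` on `|x| ≤ 1`). [folklore] -/
theorem exp_quarter_le : Real.exp (1 / 4 : ℝ) ≤ 3 / 2 := by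
  have h := Real.abs_exp_sub_one_sub_id_le (x := (1 / 4 : ℝ)) (by rw [abs_of_nonneg (by norm_num)]; norm_num)
  have h' := (abs_le.mp h).2
  nlinarith

/-- **(71) FOR THE DATUM'S OWN LARGE PLAQUETTE, ASSEMBLED** (`SU(2)`, `d = 3`): see the module docstring. [cite: Balaban1985UV3, (67)-(71) p.273] -/
theorem quarter_pFun_sq_le_localAction (hγ : 0 < γ) (hγ1 : γ ≤ 1) {b₀ : ℝ} (hb₀ : 0 ≤ b₀) (p₀ : ℝ) {C68 : ℝ} (hC68 : 0 ≤ C68)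
    (h42 : Constraint42Top D) (h68 : Regularity68Levels D b₀ p₀ C68)
    {K j : ℕ} (hjK : j ≤ K) (h : D.Hist K j) (W : GaugeField (F.P K) j (Matrix.specialUnitaryGroup (Fin 2) ℂ)) (hadm : D.Adm K j h W)
    (p' : Plaq (F.P K) j)
    (hΩ : {x : Site (F.P K) 0 | ∀ ι, ∃ e : ℤ, |e| ≤ 8 * ((F.P K).L : ℤ) ^ j ∧
      x ι = toFine j p'.src ι + (e : ZMod ((F.P K).sitesPerDir 0))} ⊆ D.Ω K j h j)
    (hlarge : θBal F.L γ b₀ p₀ (K - j) ≤ GaugeGroup.dist1 (GaugeField.plaqHol W p'))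
    (hθ1 : ((((3 + 2) * F.L : ℕ) : ℝ) ^ 2 / 4) * (C68 * θBal F.L γ b₀ p₀ (K - j)) ≤ 1 / 10)
    (hθ2 : 540 * (435 ^ 2 * (C68 * (((3 + 2) * F.L : ℕ) : ℝ) ^ 2 / 4) ^ 4) * θBal F.L γ b₀ p₀ (K - j) ^ 2 ≤ 1 / 4) :
    ∃ R₀ : Finset (Plaq (F.P K) 0),
      (∀ q ∈ R₀, ∀ ι, ∃ e : ℤ, |e| ≤ 3 * (((F.P K).L : ℤ) ^ j - 1) ∧
        q.src ι = toFine j p'.src ι + (e : ZMod ((F.P K).sitesPerDir 0))) ∧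
      (1 / 4 : ℝ) * B10.pFun b₀ p₀ (Real.sqrt (γ * ((F.L : ℝ)⁻¹) ^ (K - j))) ^ 2 ≤
        (F.scheme ℰp γ).β K * ∑ q ∈ R₀, (1 - reTr (GaugeField.plaqHol (D.Umin K j h W) q)) := by
  -- the regions under `p'`
  obtain ⟨ctr, R, hcj, hstep, hRj, hfoot, hcard, hR⟩ := exists_nested_regions p'
  have hd : (F.P K).d = 3 := rfl
  have hPL : (F.P K).L = F.L := rfl
  -- names
  set θ : ℝ := θBal F.L γ b₀ p₀ (K - j) with hθ
  set Lr : ℝ := (F.L : ℝ) with hLr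
  have hθ0 : 0 ≤ θ := HistoryTailBoundedHeight.θBal_nonneg' F hγ hγ1 hb₀ p₀ (K - j)
  have hL3 : 3 ≤ F.L := by
    obtain ⟨hodd, hgt⟩ := F.hL
    rcases hodd with ⟨m, hm⟩
    omega
  have hL2r : (2 : ℝ) ≤ Lr := by rw [hLr]; exact_mod_cast (by omega : 2 ≤ F.L)
  have hL1r : (1 : ℝ) ≤ Lr := by linarith
  -- `p'` itself has its corners in the fine box, hence lies in `plaqsIn j (Ω_j)`
  have hctr0 : toFine j (ctr j) = toFine j p'.src := by rw [hcj]
  have hp'box : ∀ w ∈ ({p'.src, p'.src.shift p'.μ, p'.src.shift p'.ν, (p'.src.shift p'.μ).shift p'.ν} : Set (Site (F.P K) j)),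
      ∀ ι, ∃ e : ℤ, |e| ≤ 8 * ((F.P K).L : ℤ) ^ j ∧ toFine j w ι = toFine j p'.src ι + (e : ZMod ((F.P K).sitesPerDir 0)) := by
    intro w hw
    -- `w = p'.src + δ` with `δ ∈ {0,1,2}`-valued offsets of sup-norm ≤ 2
    have hself : ∀ ι, ∃ e : ℤ, |e| ≤ 0 ∧ p'.src ι = p'.src ι + (e : ZMod ((F.P K).sitesPerDir j)) :=
      fun ι => ⟨0, by simp, by simp⟩
    have hwbox : ∀ ι, ∃ e : ℤ, |e| ≤ 2 ∧ w ι = p'.src ι + (e : ZMod ((F.P K).sitesPerDir j)) := by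
      simp only [Set.mem_insert_iff, Set.mem_singleton_iff] at hw
      rcases hw with rfl | rfl | rfl | rfl
      · exact box_mono (by norm_num) hself
      · exact box_mono (by norm_num) (shift_mem_box p'.μ hself)
      · exact box_mono (by norm_num) (shift_mem_box p'.ν hself)
      · exact box_mono (by norm_num) (shift_mem_box p'.ν (shift_mem_box p'.μ hself))
    choose e he hwe using hwbox
    have hw' : w = p'.src + (show Site (F.P K) j from fun ι => ((e ι : ℤ) : ZMod ((F.P K).sitesPerDir j))) := by
      funext ι; exact hwe ι
    intro ι
    refine ⟨((F.P K).L : ℤ) ^ j * e ι, ?_, ?_⟩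
    · have h1 := abs_le.mp (he ι)
      have hLj : (0 : ℤ) ≤ ((F.P K).L : ℤ) ^ j := by positivity
      rw [abs_le]; constructor <;> nlinarith [mul_le_mul_of_nonneg_left h1.1 hLj, mul_le_mul_of_nonneg_left h1.2 hLj]
    · rw [hw', toFine_add_intVec]; rfl
  have hp'in : p' ∈ plaqsIn j (D.Ω K j h j) := by
    rw [mem_plaqsIn_iff]
    intro x hx
    simp only [cornerSet, Set.mem_insert_iff, Set.mem_singleton_iff] at hx
    apply hΩ
    rcases hx with rfl | rfl | rfl | rfl
    · exact hp'box _ (by simp)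
    · exact hp'box _ (by simp)
    · exact hp'box _ (by simp)
    · exact hp'box _ (by simp)
  -- the weights `ε_s = ¼·2^{−(j−s)}` and `Pm = 3/2`
  set ε : ℕ → ℝ := fun s => (1 / 4 : ℝ) * ((1 : ℝ) / 2) ^ (j - s) with hεdef
  have hεpos : ∀ s, 0 < ε s := fun s => by positivity
  have hprod : ∏ s ∈ Finset.range j, (1 + ε s) ≤ 3 / 2 :=
    (prod_one_add_geometric_le (ε₀ := 1 / 4) (by norm_num) ε j (fun s _ => (hεpos s).le) (fun s _ => le_rfl)).trans
      exp_quarter_le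
  -- the `hbox` hypothesis from the fine-box inclusion
  have hbox : ∀ s, s < j → ∀ q ∈ R (s + 1), ∀ c : PBond (F.P K) (s + 1),
      (c = ⟨q.src, q.μ⟩ ∨ c = ⟨q.src.shift q.μ, q.ν⟩ ∨ c = ⟨q.src.shift q.ν, q.μ⟩ ∨ c = ⟨q.src, q.ν⟩) →
        ∀ z : Site (F.P K) s,
          (∀ ν, ∃ e : ℤ, |e| ≤ (((F.P K).d + 2) * (F.P K).L + 2 : ℕ) ∧
            z ν = (emb c.src) ν + (e : ZMod ((F.P K).sitesPerDir s))) →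
          ∀ (a b : Fin (F.P K).d) (hab : a < b), (⟨z, a, b, hab⟩ : Plaq (F.P K) s) ∈ plaqsIn s (D.Λ K j h j) := by
    intro s hs q hq c hc z hz a b hab
    rw [Λ_top]
    exact mem_plaqsIn_of_fineBox_subset hd p' ctr hcj hstep (D.Ω K j h j) hΩ hs q
      ((hfoot (s + 1) (by omega) q hq).2.2) c hc z hz a b hab
  -- the chain at the composite minimiser
  have hchain := smallFactor71_top hγ hγ1 hb₀ p₀ hC68 h42 h68 hjK h W hadm p' hp'in hlarge hθ1 ε hεpos hprod R hRj hR hbox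
  -- the remainder under the profile
  set a : ℕ → ℝ := fun s => C68 * θ * (((F.L : ℝ) ^ (j - s))⁻¹) ^ 2 with hadef
  set Dsq : ℝ := (((3 + 2) * F.L : ℕ) : ℝ) ^ 2 with hDsq
  have hDsq0 : 0 ≤ Dsq := by positivity
  have hrem := remainder_le (L := Lr) (θ := θ) (C := C68) (N₀ := 216) (E₀ := 5) (Pm := 3 / 2) (Dsq := Dsq)
    hL2r (by norm_num) (by norm_num) hDsq0 j ε a (fun s => ((R (s + 1)).card : ℝ))
    (fun s _ => (hεpos s).le) hprod (fun s _ => by positivity)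
    (fun s hs => by
      have hc := hcard (s + 1) (by omega)
      rw [hd, hPL] at hc
      have : (6 * (F.L : ℝ) ^ (j - (s + 1))) ^ 3 = 216 * (Lr ^ 3) ^ (j - 1 - s) := by
        rw [hLr, show j - (s + 1) = j - 1 - s by omega, mul_pow, ← pow_mul, ← pow_mul, mul_comm 3 (j - 1 - s)]; norm_num
      rw [← this]; exact hc)
    (fun s hs => by
      show 1 + ((1 / 4 : ℝ) * ((1 : ℝ) / 2) ^ (j - s))⁻¹ ≤ 5 * 2 ^ (j - s)
      have h2 : (1 : ℝ) ≤ 2 ^ (j - s) := one_le_pow₀ (by norm_num)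
      rw [mul_inv, ← inv_pow, one_div, inv_inv]
      norm_num
      linarith)
    (fun s _ => by positivity)
    (fun s hs => by
      show C68 * θ * (((F.L : ℝ) ^ (j - s))⁻¹) ^ 2 ≤ C68 * θ / (Lr ^ 2) ^ (j - s)
      rw [hLr, ← pow_mul, mul_comm 2 (j - s), pow_mul, inv_pow, div_eq_mul_inv])
  -- `β_{K−j}·Rem ≤ ¼·p²`
  have hβi0 : 0 ≤ (F.scheme ℰp γ).β (K - j) := F.scheme_β_nonneg ℰp hγ.le (K - j)
  have hβθ : (F.scheme ℰp γ).β (K - j) * θ ^ 2 = B10.pFun b₀ p₀ (Real.sqrt (γ * ((F.L : ℝ)⁻¹) ^ (K - j))) ^ 2 :=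
    beta_mul_θBal_sq F hγ b₀ p₀ (K - j)
  set P2 : ℝ := B10.pFun b₀ p₀ (Real.sqrt (γ * ((F.L : ℝ)⁻¹) ^ (K - j))) ^ 2 with hP2
  have hP20 : 0 ≤ P2 := sq_nonneg _
  set Rem : ℝ := ∑ s ∈ Finset.range j, (∏ u ∈ Finset.Ico (s + 1) j, ((1 + ε u) * Lr)) *
      (((R (s + 1)).card : ℝ) * ((1 + (ε s)⁻¹) * (435 * (Dsq / 4 * a s) ^ 2) ^ 2)) with hRem
  have hM : (1 / 3 : ℝ) * ((3 / 2) * 216 * 5 * (435 ^ 2 * (C68 * Dsq / 4) ^ 4 * θ ^ 4)) =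
      540 * (435 ^ 2 * (C68 * Dsq / 4) ^ 4) * θ ^ 2 * θ ^ 2 := by ring
  have hβRem : (F.scheme ℰp γ).β (K - j) * Rem ≤ (1 / 4) * P2 := by
    have h1 : (F.scheme ℰp γ).β (K - j) * Rem ≤
        (F.scheme ℰp γ).β (K - j) * (540 * (435 ^ 2 * (C68 * Dsq / 4) ^ 4) * θ ^ 2 * θ ^ 2) :=
      mul_le_mul_of_nonneg_left (hrem.trans_eq hM) hβi0
    have h2 : (F.scheme ℰp γ).β (K - j) * (540 * (435 ^ 2 * (C68 * Dsq / 4) ^ 4) * θ ^ 2 * θ ^ 2) =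
        (540 * (435 ^ 2 * (C68 * Dsq / 4) ^ 4) * θ ^ 2) * P2 := by rw [← hβθ]; ring
    have hθ2' : 540 * (435 ^ 2 * (C68 * Dsq / 4) ^ 4) * θ ^ 2 ≤ 1 / 4 := by
      have : C68 * Dsq / 4 = C68 * (((3 + 2) * F.L : ℕ) : ℝ) ^ 2 / 4 := by rw [hDsq]
      rw [this]; exact hθ2
    calc (F.scheme ℰp γ).β (K - j) * Rem ≤ (540 * (435 ^ 2 * (C68 * Dsq / 4) ^ 4) * θ ^ 2) * P2 := h1.trans_eq h2
      _ ≤ (1 / 4) * P2 := mul_le_mul_of_nonneg_right hθ2' hP20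
  -- assemble: `(P2 − βRem)/(2·(3/2)) ≥ ¼·P2`
  refine ⟨R 0, fun q hq => ?_, ?_⟩
  · -- footprint of `R 0`: `ctr 0 = toFine j p'.src`
    have h0 := (hfoot 0 (Nat.zero_le j) q hq).2.2
    have hc0 : ctr 0 = toFine j p'.src := by
      have := toFine_ctr ctr hstep 0 (Nat.zero_le j)
      simpa [hcj] using this
    intro ι
    obtain ⟨e, he, hqe⟩ := h0 ι
    refine ⟨e, by simpa using he, ?_⟩
    rw [hqe, hc0]
  · have hfinal : (P2 - (F.scheme ℰp γ).β (K - j) * Rem) / (2 * (3 / 2)) ≤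
        (F.scheme ℰp γ).β K * ∑ q ∈ R 0, (1 - reTr (GaugeField.plaqHol (D.Umin K j h W) q)) := by
      have := hchain
      simp only [hRem, hadef, hDsq, hLr, hP2] at this ⊢
      exact this
    have hlow : (1 / 4 : ℝ) * P2 ≤ (P2 - (F.scheme ℰp γ).β (K - j) * Rem) / (2 * (3 / 2)) := by
      rw [le_div_iff₀ (by norm_num)]; linarith
    exact hlow.trans hfinal

/-! ## Appendix (v1.1, same seat): the two smallness conditions from a coupling threshold -/

/-- **THE SMALLNESS REGIME OF `quarter_pFun_sq_le_localAction` HOLDS BELOW A COUPLING THRESHOLD** `γ₁(L, C68, b₀, p₀) ∈ (0, 1]`, uniformly in the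
cut-off `K` and the height `j` (both conditions are of the form `A·θBal ≤ c`, `M·θBal² ≤ c′`; take `θBal ≤ 1/(10A + 4M + 1)` by
`T3Thresholds.exists_gamma_forall_θBal_le`) — Bałaban's «for g_j sufficiently small» of (71) as a γ-threshold. [cite: Balaban1985UV3, (71) p.273] -/
theorem exists_gamma_quarter_regime (F : T3Family) {b₀ p₀ : ℝ} (hb : 0 < b₀) (hp : 0 < p₀) {C68 : ℝ} (hC68 : 0 ≤ C68) :
    ∃ γ₁ : ℝ, 0 < γ₁ ∧ γ₁ ≤ 1 ∧ ∀ γ : ℝ, 0 < γ → γ ≤ γ₁ → ∀ K j : ℕ,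
      ((((3 + 2) * F.L : ℕ) : ℝ) ^ 2 / 4) * (C68 * θBal F.L γ b₀ p₀ (K - j)) ≤ 1 / 10 ∧
      540 * (435 ^ 2 * (C68 * (((3 + 2) * F.L : ℕ) : ℝ) ^ 2 / 4) ^ 4) * θBal F.L γ b₀ p₀ (K - j) ^ 2 ≤ 1 / 4 := by
  set A : ℝ := ((((3 + 2) * F.L : ℕ) : ℝ) ^ 2 / 4) * C68 with hA
  set M : ℝ := 540 * (435 ^ 2 * (C68 * (((3 + 2) * F.L : ℕ) : ℝ) ^ 2 / 4) ^ 4) with hM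
  have hA0 : 0 ≤ A := by positivity
  have hM0 : 0 ≤ M := by positivity
  have hden : 0 < 10 * A + 4 * M + 1 := by positivity
  set σ : ℝ := 1 / (10 * A + 4 * M + 1) with hσ
  have hσ0 : 0 < σ := by positivity
  have hσ1 : σ ≤ 1 := by
    rw [hσ, div_le_one hden]; linarith
  obtain ⟨γ₁, hγ₁, hγ₁1, hθ⟩ := T3Thresholds.exists_gamma_forall_θBal_le hb hp hσ0
  refine ⟨γ₁, hγ₁, hγ₁1, fun γ hγ hγle K j => ?_⟩
  have hL1 : 1 ≤ F.L := F.hL.2.le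
  have hθσ : θBal F.L γ b₀ p₀ (K - j) ≤ σ := hθ F.L hL1 γ hγ hγle (K - j)
  have hθ0 : 0 ≤ θBal F.L γ b₀ p₀ (K - j) := HistoryTailBoundedHeight.θBal_nonneg' F hγ (hγle.trans hγ₁1) hb.le p₀ (K - j)
  have hAσ : A * σ ≤ 1 / 10 := by
    rw [hσ, ← mul_div_assoc, mul_one, div_le_iff₀ hden]; nlinarith
  have hMσ : M * σ ≤ 1 / 4 := by
    rw [hσ, ← mul_div_assoc, mul_one, div_le_iff₀ hden]; nlinarith
  constructor
  · calc ((((3 + 2) * F.L : ℕ) : ℝ) ^ 2 / 4) * (C68 * θBal F.L γ b₀ p₀ (K - j)) = A * θBal F.L γ b₀ p₀ (K - j) := by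
          rw [hA]; ring
      _ ≤ A * σ := mul_le_mul_of_nonneg_left hθσ hA0
      _ ≤ 1 / 10 := hAσ
  · have hsq : θBal F.L γ b₀ p₀ (K - j) ^ 2 ≤ σ := by
      calc θBal F.L γ b₀ p₀ (K - j) ^ 2 ≤ σ ^ 2 := pow_le_pow_left₀ hθ0 hθσ 2
        _ ≤ σ := by nlinarith
    calc 540 * (435 ^ 2 * (C68 * (((3 + 2) * F.L : ℕ) : ℝ) ^ 2 / 4) ^ 4) * θBal F.L γ b₀ p₀ (K - j) ^ 2
        = M * θBal F.L γ b₀ p₀ (K - j) ^ 2 := by rw [hM]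
      _ ≤ M * σ := mul_le_mul_of_nonneg_left hsq hM0
      _ ≤ 1 / 4 := hMσ

/-! ## Appendix (v1.2, same seat): the small factors of SEVERAL top-level large plaquettes add up inside the main term -/

/-- **THE TOP-LEVEL SMALL FACTORS OF A SEPARATED FAMILY ADD UP INSIDE THE MAIN TERM** (for `stub_diluteFamilyGlobal`'s prover): if every member
`q` of a finite family `S` of level-`j` plaquettes obeys the conclusion of `quarter_pFun_sq_le_localAction` with a local region `R₀(q)`, and the
regions are pairwise disjoint (they are boxes of radius `3L^j` around `toFine j q.src`, so `7L^j`-separated members have disjoint regions — the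
separation of STUB 3's mirror family), then under `MainTermIsAction` the main term of the (41)-exponent carries ALL the small factors:
`|S|·¼p(g_{K−j})² ≤ mainT^{(K)}_j(h, W) = β_K·A(U_j(h,W))` — every plaquette term of the Wilson action is non-negative
(the argument of `T3AlphaInputsACSchemas.localised_le_mainT` on the disjoint union). [cite: Balaban1985UV3, (41) p.266 and (71) p.273] -/
theorem card_mul_quarter_le_mainT (hM : MainTermIsAction D) (hγ : 0 ≤ γ) {K j : ℕ} (h : D.Hist K j)
    (W : GaugeField (F.P K) j (Matrix.specialUnitaryGroup (Fin 2) ℂ)) (S : Finset (Plaq (F.P K) j))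
    (R₀ : Plaq (F.P K) j → Finset (Plaq (F.P K) 0)) (hdisj : (S : Set (Plaq (F.P K) j)).PairwiseDisjoint R₀) (P4 : ℝ)
    (hq : ∀ q ∈ S, P4 ≤ (F.scheme ℰp γ).β K * ∑ r ∈ R₀ q, (1 - reTr (GaugeField.plaqHol (D.Umin K j h W) r))) :
    (S.card : ℝ) * P4 ≤ D.mainT K j h W := by
  classical
  have hterm0 : ∀ r : Plaq (F.P K) 0, 0 ≤ 1 - reTr (GaugeField.plaqHol (D.Umin K j h W) r) := fun r => by
    have := GaugeGroup.reTr_le_one (GaugeField.plaqHol (D.Umin K j h W) r); linarith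
  calc (S.card : ℝ) * P4 = ∑ _q ∈ S, P4 := by rw [Finset.sum_const, nsmul_eq_mul]
    _ ≤ ∑ q ∈ S, (F.scheme ℰp γ).β K * ∑ r ∈ R₀ q, (1 - reTr (GaugeField.plaqHol (D.Umin K j h W) r)) :=
        Finset.sum_le_sum hq
    _ = (F.scheme ℰp γ).β K * ∑ r ∈ S.biUnion R₀, (1 - reTr (GaugeField.plaqHol (D.Umin K j h W) r)) := by
        rw [Finset.sum_biUnion hdisj, Finset.mul_sum]
    _ ≤ D.mainT K j h W := by
        rw [hM K j h W]
        refine mul_le_mul_of_nonneg_left ?_ (F.scheme_β_nonneg ℰp hγ K)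
        unfold wilsonAction4 wilsonAction
        simp only [one_mul]
        exact Finset.sum_le_sum_of_subset_of_nonneg (Finset.subset_univ _) fun r _ _ => hterm0 r

end Summit.QuantumFields.YangMills.Theorems.HistoryTailAlphaTopQuarter

end
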